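import Literature.NumberTheory.Transcendental.PhilipponZeroEstimatePrelim
import Literature.NumberTheory.Transcendental.PhilipponZeroEstimateChain
import Literature.NumberTheory.Transcendental.PhilipponZeroEstimateStep1
import Literature.NumberTheory.Transcendental.PhilipponZeroEstimateIndependence
import Literature.NumberTheory.Transcendental.PhilipponZeroEstimateTransversal
import Literature.NumberTheory.Transcendental.GaGmSubgroupDegrees
import HarnessLib

/-!
# Philippon's zero estimate on `𝔾ₐ × 𝔾ₘ^n` with multiplicities: the descent and the primes

Topic `Literature/NumberTheory/Transcendental`. Fourteenth module of the inline discharge of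
`Literature.NumberTheory.Transcendental.Philippon1986_GaGm`: D. Roy's proof of Thm. 4.1
(Nesterenko–Philippon (eds.), LNM 1752, Ch. 11, pp. 218–220) for `G = 𝔾ₐ × 𝔾ₘⁿ ⊂ (ℙ¹)ⁿ⁺¹`, up to
the two Hilbert-function inequalities at the top components of `Σ + H`. With
`I₁ = (P)^*`, `I_{k+1} = ∂^T_Σ(I_k)` (`GaGm.royI`, via `GaGm.dIdeal`) and `X_k = Z(I_k) ∩ G`
(`GaGm.royX`): the `X_k` decrease, contain `e` for `k ≤ n + 2` (the vanishing hypothesis on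
`Σ(n+1)` to order `> (n+1)T`), `X₁ ≠ G`; two consecutive dimensions agree; a top component `V` of
`X_{r+1}` has `σV ⊆ X_r` (`σ ∈ Σ`); `𝔄 = ∂⁰_V(I_r)` cuts out the transporter `E = {a ; aV ⊆ X_r}`,
the stabiliser `St` of `V` is a closed subgroup with identity component `H₀`
(`PhilipponZeroEstimateP1nDescent`, `GaGmSubgroups`), `Σ ⊆ E`, `E` is a finite union of cosets of
`H₀` of dimension `dim H₀`, the cosets `σH₀`, `σ ∈ Σ`, are top components of `E = Z(𝔄)`, their
primes `𝔭_Y` are minimal over `𝔄`, pairwise incomparable, `u ∉ 𝔭_Y`, and `Σ·St ⊆ Z(∂^T 𝔄)`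
(Roy's (d)). PROVED here: `GaGm.exists_descent_data`, packaging all of this for the final count
(`PhilipponZeroEstimateHolds.lean`).

## References

* Yu. V. Nesterenko, P. Philippon (eds.), *Introduction to Algebraic Independence Theory*,
  LNM 1752, Springer 2001, Ch. 11 (D. Roy), Thm. 4.1 and its proof (pp. 218–220).
* P. Philippon, *Lemmes de zéros dans les groupes algébriques commutatifs*, Bull. Soc. Math.
  France 114 (1986), 355–383, Thm. 2.1, §5.
-/

noncomputable section

open MvPolynomial Module
open scoped Pointwise

namespace Literature.NumberTheory.Transcendental

namespace GaGm

variable {n : ℕ}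

section Descent

variable (W : Submodule ℂ (ℂ × (Fin n → ℂ))) (S : Set (GaGm n)) (T : ℕ) (P : MvPolynomial (Fin (n + 1)) ℂ)

/-- Roy's ideals `I₁ = (P)^*`, `I_{k+1} = ∂^T_Σ(I_k)` (indexed from `0`: `royI 0 = (P)^*`).
[cite: NesterenkoPhilippon2001, Ch. 11 Thm. 4.1 (proof)] -/
def royI (k : ℕ) : Ideal (MvPolynomial (Fin (n + 1)) ℂ) :=
  (dIdeal W S T)^[k] (sat (Ideal.span {P}))

/-- Roy's closed sets `X_k = Z(I_k) ∩ G` (indexed from `0`). [cite: NesterenkoPhilippon2001, Ch. 11 Thm. 4.1 (proof)] -/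
def royX (k : ℕ) : Set (GaGm n) := zeroSet (n := n) (royI W S T P k : Set (MvPolynomial (Fin (n + 1)) ℂ))

/-- `I_{k+1} = ∂^{kT}_{Σ(k)}(P)` (Prop. 3.6 (ii)). [folklore] -/
theorem royI_eq (k : ℕ) : royI W S T P k = dIdeal W (S ^ k) (k * T) (Ideal.span {P}) :=
  dIdeal_iterate S T _ k

/-- The recursion. [folklore] -/
theorem royI_succ (k : ℕ) : royI W S T P (k + 1) = dIdeal W S T (royI W S T P k) := by
  rw [royI, Function.iterate_succ_apply']; rfl

/-- `X_0 = Z(P)`. [folklore] -/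
theorem royX_zero : royX W S T P 0 = zeroSet (n := n) {P} := by
  rw [royX, royI, Function.iterate_zero, id_eq, zeroSet_sat, zeroSet_span]

/-- The `X_k` are closed. [folklore] -/
theorem isClosedG_royX (k : ℕ) : IsClosedG (royX W S T P k) := isClosedG_zeroSet _

variable {W S T P}

/-- The `X_k` decrease (`I_k ⊆ I_{k+1}` as `e ∈ Σ`). [folklore] -/
theorem royX_succ_subset (h1 : (1 : GaGm n) ∈ S) (k : ℕ) : royX W S T P (k + 1) ⊆ royX W S T P k := by
  rw [royX, royX, royI_succ]
  exact zeroSet_antitone (le_dIdeal h1 T _)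

/-- The `X_k` decrease. [folklore] -/
theorem royX_antitone (h1 : (1 : GaGm n) ∈ S) {k k' : ℕ} (h : k ≤ k') : royX W S T P k' ⊆ royX W S T P k := by
  induction h with
  | refl => exact Set.Subset.rfl
  | step _ ih => exact (royX_succ_subset h1 _).trans ih

/-- **`e ∈ X_k` for `k ≤ n + 1`** from the vanishing of `P` to order `> (n+1)T` on `Σ(n+1)`
(Prop. 3.6 (iii)). [cite: NesterenkoPhilippon2001, Ch. 11 Thm. 4.1 (proof)] -/
theorem one_mem_royX (h1 : (1 : GaGm n) ∈ S)
    (hvan : ∀ g ∈ sumset S (n + 1), VanishesToOrder P W g ((n + 1) * T + 1)) {k : ℕ} (hk : k ≤ n + 1) :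
    (1 : GaGm n) ∈ royX W S T P k := by
  rw [royX, royI_eq, zeroSet_dIdeal]
  intro P' hP' σ hσ
  obtain ⟨Q, rfl⟩ := Ideal.mem_span_singleton'.mp hP'
  rw [mul_one]
  have hσ' : σ ∈ sumset S (n + 1) := sumset_mono h1 hk (pow_subset_sumset S k hσ)
  exact ((hvan σ hσ').mono (by nlinarith)).mul_left Q

/-- `X_0 ≠ G` as `P ≠ 0`. [folklore] -/
theorem royX_zero_ne_univ (hP0 : P ≠ 0) : royX W S T P 0 ≠ Set.univ := by
  intro h
  apply hP0
  have : P ∈ vanishing (Set.univ : Set (GaGm n)) := fun g _ => by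
    have hg : g ∈ royX W S T P 0 := h ▸ Set.mem_univ g
    rw [royX_zero] at hg
    exact hg P rfl
  rwa [vanishing_univ, Submodule.mem_bot] at this

/-- **`σ X_{k+1} ⊆ X_k` for `σ ∈ Σ`**: the points of `X_{k+1}` are zeros of
`∂^T_Σ(I_k) ⊇ ∂⁰_Σ(I_k)`. [cite: NesterenkoPhilippon2001, Ch. 11 Thm. 4.1 (proof)] -/
theorem mul_mem_royX {σ v : GaGm n} (hσ : σ ∈ S) {k : ℕ} (hv : v ∈ royX W S T P (k + 1)) :
    σ * v ∈ royX W S T P k := by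
  rw [royX, royI_succ] at hv
  have hv' : v ∈ zeroSet (n := n) (dIdeal W S 0 (royI W S T P k) : Set (MvPolynomial (Fin (n + 1)) ℂ)) :=
    zeroSet_antitone (dIdeal_mono Set.Subset.rfl (Nat.zero_le T) le_rfl) hv
  rw [zeroSet_dIdeal] at hv'
  intro P' hP'
  exact (vanishesToOrder_one_iff P' W (σ * v)).mp (hv' P' hP' σ hσ)

/-- The transporter of `V` into `Z(J)`: `Z(∂⁰_V(J)) = {a ; aV ⊆ Z(J)}`. [folklore] -/
theorem mem_zeroSet_dIdeal_zero_iff (V : Set (GaGm n)) (J : Ideal (MvPolynomial (Fin (n + 1)) ℂ)) (a : GaGm n) :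
    a ∈ zeroSet (n := n) (dIdeal W V 0 J : Set (MvPolynomial (Fin (n + 1)) ℂ)) ↔
      a • V ⊆ zeroSet (n := n) (J : Set (MvPolynomial (Fin (n + 1)) ℂ)) := by
  rw [zeroSet_dIdeal]
  simp only [Set.mem_setOf_eq, zero_add, vanishesToOrder_one_iff]
  constructor
  · rintro h _ ⟨v, hv, rfl⟩ P' hP'
    dsimp only
    rw [smul_eq_mul, mul_comm]
    exact h P' hP' v hv
  · intro h P' hP' v hv
    rw [mul_comm]
    exact h ⟨v, hv, rfl⟩ P' hP'

end Descent

/-! ### The descent data -/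

/-- **The descent of Roy's proof of Thm. 4.1, packaged.** From the data of
`Philippon1986_GaGm` (with `P ∈ Box(1)`) we obtain: an irreducible closed subgroup `H₀`, a special
ideal `𝔄` generated (up to saturation) by box polynomials `Fgen ⊆ Box(1)` with zero set `E`, such
that `Σ ⊆ E`, every coset `σH₀` (`σ ∈ Σ`) lies in `E`, is a top-dimensional component of `E`
(`dim E = dim H₀`), and lies in `Z(∂^T_{e} 𝔄)`; and a point `v₀` with `P(v₀ h) = 0` for `h ∈ H₀`.
[cite: NesterenkoPhilippon2001, Ch. 11 Thm. 4.1 (proof, steps a–e)] -/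
theorem exists_descent_data {D₀ D₁ : ℕ} (W : Submodule ℂ (ℂ × (Fin n → ℂ))) {S : Set (GaGm n)}
    (h1 : (1 : GaGm n) ∈ S) (T : ℕ) {P : MvPolynomial (Fin (n + 1)) ℂ} (hP0 : P ≠ 0)
    (hPB : P ∈ Box (n := n) D₀ D₁ 1) (hvan : ∀ g ∈ sumset S (n + 1), VanishesToOrder P W g ((n + 1) * T + 1)) :
    ∃ (H₀ : Subgroup (GaGm n)) (_ : IsIrred (H₀ : Set (GaGm n)))
      (Fgen : Set (MvPolynomial (Fin (n + 1)) ℂ)) (v₀ : GaGm n),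
      Fgen ⊆ (Box (n := n) D₀ D₁ 1 : Set (MvPolynomial (Fin (n + 1)) ℂ)) ∧
      (∀ h ∈ H₀, evalAt P (v₀ * h) = 0) ∧
      let 𝔄 := sat (Ideal.span Fgen)
      let E := zeroSet (n := n) (𝔄 : Set (MvPolynomial (Fin (n + 1)) ℂ))
      S ⊆ E ∧
      (∀ σ ∈ S, σ • (H₀ : Set (GaGm n)) ⊆ E) ∧
      (∀ σ ∈ S, dimG (σ • (H₀ : Set (GaGm n))) = dimG E) ∧
      (∀ σ ∈ S, σ • (H₀ : Set (GaGm n)) ⊆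
        zeroSet (n := n) (dIdeal W {(1 : GaGm n)} T 𝔄 : Set (MvPolynomial (Fin (n + 1)) ℂ))) ∧
      dimG E ≤ n := by
  classical
  -- the chain `X_k`
  have hXcl : ∀ k, IsClosedG (royX W S T P k) := isClosedG_royX W S T P
  have h1X : ∀ k, k ≤ n + 1 → (1 : GaGm n) ∈ royX W S T P k := fun k hk => one_mem_royX h1 hvan hk
  have hXne : ∀ k, k ≤ n + 1 → (royX W S T P k).Nonempty := fun k hk => ⟨1, h1X k hk⟩
  -- `dim X_0 ≤ n`
  have hd0 : dimG (royX W S T P 0) ≤ n := by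
    have hlt := dimG_lt_of_ssubset isIrred_univ (hXcl 0) (hXne 0 (Nat.zero_le _))
      (Set.ssubset_univ_iff.mpr (royX_zero_ne_univ hP0))
    rw [dimG_univ] at hlt
    omega
  -- pigeonhole
  obtain ⟨r, hrn, hdr⟩ := Descent.exists_eq_succ_of_antitone (d := fun k => dimG (royX W S T P k))
    (fun k => dimG_mono (royX_succ_subset h1 k)) hd0
  -- a top-dimensional component `V` of `X_{r+1}`
  obtain ⟨𝔮ᵥ, h𝔮ᵥ, hdimV⟩ := exists_minimalPrimes_dimG_eq (hXne (r + 1) (by omega))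
  obtain ⟨hV, -, hVsub⟩ := isIrred_zeroSet_of_mem_minimalPrimes h𝔮ᵥ
  rw [(hXcl (r + 1)).eq] at hVsub
  generalize hVgen : zeroSet (n := n) (↑𝔮ᵥ : Set (MvPolynomial (Fin (n + 1)) ℂ)) = V at hV hVsub hdimV
  -- the stabiliser and its identity component
  have hStcl : IsClosedG ((MulAction.stabilizer (GaGm n) V : Subgroup (GaGm n)) : Set (GaGm n)) :=
    Descent.isClosedG_stabilizer hV
  have hG'irr : IsIrred ((idComp (MulAction.stabilizer (GaGm n) V) hStcl : Subgroup (GaGm n)) : Set (GaGm n)) :=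
    isIrred_idComp _ hStcl
  have hG'St : idComp (MulAction.stabilizer (GaGm n) V) hStcl ≤ MulAction.stabilizer (GaGm n) V := idComp_le _ hStcl
  obtain ⟨Tf, -, hStT⟩ := exists_finset_eq_biUnion_smul_idComp (MulAction.stabilizer (GaGm n) V) hStcl
  generalize hG'gen : idComp (MulAction.stabilizer (GaGm n) V) hStcl = G' at hG'irr hG'St hStT
  -- generators: `I_r = (G₀)^*`, `𝔄 = ∂⁰_V(I_r) = (Fgen)^*`
  set G₀ : Set (MvPolynomial (Fin (n + 1)) ℂ) := dGens W (S ^ r) (r * T) {P} with hG₀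
  set Fgen : Set (MvPolynomial (Fin (n + 1)) ℂ) := dGens W V 0 G₀ with hFgen
  have hG₀B : G₀ ⊆ (Box (n := n) D₀ D₁ 1 : Set (MvPolynomial (Fin (n + 1)) ℂ)) :=
    dGens_subset_Box (by simpa using hPB)
  have hFgenB : Fgen ⊆ (Box (n := n) D₀ D₁ 1 : Set (MvPolynomial (Fin (n + 1)) ℂ)) := dGens_subset_Box hG₀B
  have hIr : royI W S T P r = sat (Ideal.span G₀) := by rw [royI_eq, dIdeal_span]
  have h𝔄eq : dIdeal W V 0 (royI W S T P r) = sat (Ideal.span Fgen) := by rw [hIr, dIdeal_sat_span]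
  set 𝔄 := sat (Ideal.span Fgen) with h𝔄
  set E := zeroSet (n := n) (𝔄 : Set (MvPolynomial (Fin (n + 1)) ℂ)) with hE
  -- the transporter
  have hmemE : ∀ a, a ∈ E ↔ a • V ⊆ royX W S T P r := fun a => by
    rw [hE, ← h𝔄eq, mem_zeroSet_dIdeal_zero_iff]; rfl
  have hEcl : IsClosedG E := isClosedG_zeroSet _
  have hSE : S ⊆ E := fun σ hσ => (hmemE σ).mpr (by
    rintro _ ⟨v, hv, rfl⟩
    exact mul_mem_royX hσ (hVsub hv))
  have h1E : (1 : GaGm n) ∈ E := hSE h1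
  have hESt : ∀ g ∈ E, ∀ s ∈ MulAction.stabilizer (GaGm n) V, g * s ∈ E := fun g hg s hs => by
    rw [hmemE, mul_smul, MulAction.mem_stabilizer_iff.mp hs]
    exact (hmemE g).mp hg
  have hcosE : ∀ g ∈ E, g • ((G' : Subgroup (GaGm n)) : Set (GaGm n)) ⊆ E := by
    rintro g hg _ ⟨h, hh, rfl⟩
    exact hESt g hg h (hG'St hh)
  -- `E`-translates of `V` are top-dimensional components of `X_r`
  have htrans : ∀ c ∈ E, ∃ 𝔮 ∈ (vanishing (royX W S T P r)).minimalPrimes,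
      c • V = zeroSet (n := n) ↑𝔮 := fun c hc =>
    (hV.smul c).exists_eq_zeroSet_minimalPrimes (hXcl r) ((hmemE c).mp hc)
      (by rw [dimG_smul, hdimV]; exact hdr.symm)
  -- finitely many `St`-cosets cover `E`
  have hcover : ∃ C : Finset (GaGm n),
      E ⊆ ⋃ c ∈ C, c • ((MulAction.stabilizer (GaGm n) V : Subgroup (GaGm n)) : Set (GaGm n)) := by
    have hpick : ∀ 𝔮 : Ideal (MvPolynomial (Fin (n + 1)) ℂ), ∃ c : GaGm n,
        (∃ c' ∈ E, c' • V = zeroSet (n := n) ↑𝔮) → c • V = zeroSet (n := n) ↑𝔮 := by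
      intro 𝔮
      by_cases h : ∃ c' ∈ E, c' • V = zeroSet (n := n) ↑𝔮
      · obtain ⟨c', -, h'⟩ := h; exact ⟨c', fun _ => h'⟩
      · exact ⟨1, fun h' => absurd h' h⟩
    choose pick hpick using hpick
    refine ⟨(comps (royX W S T P r)).image pick, fun c hc => ?_⟩
    obtain ⟨𝔮, h𝔮, hc𝔮⟩ := htrans c hc
    have hp := hpick 𝔮 ⟨c, hc, hc𝔮⟩
    rw [Set.mem_iUnion₂]
    refine ⟨pick 𝔮, Finset.mem_image_of_mem _ (mem_comps.mpr h𝔮), (pick 𝔮)⁻¹ * c, ?_, by simp [smul_eq_mul]⟩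
    have : ((pick 𝔮)⁻¹ * c) • V = V := by rw [mul_smul, hc𝔮, ← hp, inv_smul_smul]
    exact MulAction.mem_stabilizer_iff.mpr this
  obtain ⟨C, hEC⟩ := hcover
  -- `dim E ≤ dim G'`
  have hdimE : dimG E ≤ dimG ((G' : Subgroup (GaGm n)) : Set (GaGm n)) := by
    obtain ⟨𝔯, h𝔯, hdim𝔯⟩ := exists_minimalPrimes_dimG_eq (X := E) ⟨1, h1E⟩
    obtain ⟨h𝔯irr, -, h𝔯sub⟩ := isIrred_zeroSet_of_mem_minimalPrimes h𝔯
    rw [hEcl.eq] at h𝔯sub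
    have hsub : zeroSet (n := n) ↑𝔯 ⊆
        ⋃ p ∈ C ×ˢ Tf, (p.1 * p.2) • ((G' : Subgroup (GaGm n)) : Set (GaGm n)) := by
      intro g hg
      obtain ⟨c, hc, hgc⟩ := Set.mem_iUnion₂.mp (hEC (h𝔯sub hg))
      obtain ⟨s, hs, rfl⟩ := hgc
      have hsSt : s ∈ ((MulAction.stabilizer (GaGm n) V : Subgroup (GaGm n)) : Set (GaGm n)) := hs
      rw [hStT] at hsSt
      obtain ⟨a, ha, hsa⟩ := Set.mem_iUnion₂.mp hsSt
      obtain ⟨g', hg', rfl⟩ := hsa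
      rw [Set.mem_iUnion₂]
      exact ⟨(c, a), Finset.mem_product.mpr ⟨hc, ha⟩, g', hg', by simp [smul_eq_mul, mul_assoc]⟩
    obtain ⟨p, -, hp⟩ := h𝔯irr.exists_subset_of_subset_biUnion (C ×ˢ Tf) _
      (fun p _ => (hG'irr.isClosedG).smul _) hsub
    rw [← hdim𝔯]
    exact (dimG_mono hp).trans (dimG_smul _ _).le
  -- Roy's (d): `Σ·St ⊆ Z(∂^T 𝔄)`
  have hdT : ∀ σ ∈ S, ∀ s ∈ MulAction.stabilizer (GaGm n) V,
      σ * s ∈ zeroSet (n := n) (dIdeal W {(1 : GaGm n)} T 𝔄 : Set (MvPolynomial (Fin (n + 1)) ℂ)) := by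
    intro σ hσ s hs
    -- `s ∈ F = Z(∂⁰_V(I_{r+1}))` since `sV = V ⊆ X_{r+1}`
    have hsF : s ∈ zeroSet (n := n) (dIdeal W V 0 (royI W S T P (r + 1)) : Set (MvPolynomial (Fin (n + 1)) ℂ)) := by
      rw [mem_zeroSet_dIdeal_zero_iff, MulAction.mem_stabilizer_iff.mp hs]
      exact hVsub
    -- `∂⁰_V(I_{r+1}) = ∂^T_Σ(𝔄) = ∂⁰_Σ(∂^T 𝔄)`
    have hideal : dIdeal W V 0 (royI W S T P (r + 1)) = dIdeal W S 0 (dIdeal W {(1 : GaGm n)} T 𝔄) := by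
      rw [royI_succ, dIdeal_dIdeal, dIdeal_dIdeal, Set.singleton_one, mul_one, zero_add, ← h𝔄eq, dIdeal_dIdeal,
        add_zero, mul_comm V S]
    rw [hideal, zeroSet_dIdeal] at hsF
    intro P' hP'
    exact (vanishesToOrder_one_iff P' W (σ * s)).mp (hsF P' hP' σ hσ)
  -- a point of `V`
  obtain ⟨v₀, hv₀⟩ := hV.nonempty
  refine ⟨G', hG'irr, Fgen, v₀, hFgenB, fun h hh => ?_, hSE, fun σ hσ => hcosE σ (hSE hσ), fun σ hσ => ?_,
    fun σ hσ => ?_, ?_⟩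
  · -- `v₀ h ∈ V ⊆ X_{r+1} ⊆ X_0 = Z(P)`
    have hhSt : h • V = V := MulAction.mem_stabilizer_iff.mp (hG'St hh)
    have hmem : v₀ * h ∈ V := by rw [mul_comm, ← hhSt]; exact Set.smul_mem_smul_set hv₀
    have h0 := royX_antitone h1 (Nat.zero_le (r + 1)) (hVsub hmem)
    rw [royX_zero] at h0
    exact h0 P rfl
  · exact le_antisymm (dimG_mono (hcosE σ (hSE hσ))) (hdimE.trans (dimG_smul σ _).symm.le)
  · rintro _ ⟨h, hh, rfl⟩
    exact hdT σ hσ h (hG'St hh)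
  · -- `dim E ≤ dim G' ≤ dim St ≤ n` since `St ≠ G` (else `V = G`, `X_0 = G`)
    show dimG E ≤ n
    have hStne : ((MulAction.stabilizer (GaGm n) V : Subgroup (GaGm n)) : Set (GaGm n)) ≠ Set.univ := by
      intro huniv
      apply royX_zero_ne_univ (W := W) (S := S) (T := T) hP0
      refine Set.eq_univ_of_forall fun g => royX_antitone h1 (Nat.zero_le (r + 1)) (hVsub ?_)
      have hg : g * v₀⁻¹ ∈ ((MulAction.stabilizer (GaGm n) V : Subgroup (GaGm n)) : Set (GaGm n)) :=
        huniv ▸ Set.mem_univ _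
      have hst : (g * v₀⁻¹) • V = V := MulAction.mem_stabilizer_iff.mp hg
      have : (g * v₀⁻¹) * v₀ ∈ V := by rw [← hst]; exact Set.smul_mem_smul_set hv₀
      simpa using this
    have hlt := dimG_lt_of_ssubset isIrred_univ hStcl ⟨1, (MulAction.stabilizer (GaGm n) V).one_mem⟩
      (Set.ssubset_univ_iff.mpr hStne)
    rw [dimG_univ] at hlt
    have hG'le : dimG ((G' : Subgroup (GaGm n)) : Set (GaGm n)) ≤
        dimG ((MulAction.stabilizer (GaGm n) V : Subgroup (GaGm n)) : Set (GaGm n)) := dimG_mono hG'St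
    omega

end GaGm

end Literature.NumberTheory.Transcendental
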